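import Summits.CriticalPhenomena.PercolationContinuityZ3.Theorems.FK.SamePContinuationUnconditional
import Summits.CriticalPhenomena.PercolationContinuityZ3.Theorems.FK.CriticalPointBounds
import Literature.Barriers.CriticalPhenomena.RandomClusterFirstOrderNarrowProofs
import Summits.CriticalPhenomena.PercolationContinuityZ3.Theorems.FK.Transplant.KNFreeTheorem6Consequences
import Summits.CriticalPhenomena.PercolationContinuityZ3.Theorems.FK.Transplant.KNFreeRegressionQOneRecord
import Summits.CriticalPhenomena.PercolationContinuityZ3.Theorems.FK.ContinuityQOneBridge
import HarnessLib

/-!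
# FK-continuity transplant, FO-12 (2): no criterion at criticality, and the crux family placed against the
# large-`q` first-order barrier (Grimmett 2006 Thm. (7.33)(b)) — kernel theorems, unconditional

Cell `fk-continuity` (bschramm), row FO-12 ("barrier sanity … and its agreement with `RandomClusterFirstOrderNarrow`");
LEAF file (nothing imports it); support file (`--supports stmt-CriticalPhenomena-4575`); builds on p205010
(kernel theorem, internal audit signed; external expert review pending).  No definitions, no named-fact hypotheses,
no sorries, standard axioms.

HONEST FRAMING.  Everything below is a consequence of the PROVED first-order regime `q > Q(d)` (Grimmett 2006
Thm. (7.33)(b), BOTH halves `θ⁰(p_c(q), q) = 0 < θ¹(p_c(q), q)` — a TREE THEOREM,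
`Literature.Barriers.CriticalPhenomena.RandomClusterFirstOrderNarrow_holds`, Pirogov–Sinai contour analysis, 2026-08-15)
and of the cell's continuation principle C2 (`fkContinuationPrinciple`, row FO-11, unconditional for every `d` and
`q ≥ 1`), plus C3b (`fkLawfulOfCriterion`, row FT-07) and the `q = 1` regression (row FT-09) where named.  The theorems
say NOTHING about `q ∈ (1, Q(d)]`, in particular nothing about the cell's targets (`d = 3`, `q ∈ (1,2]`), and nothing
about the open inputs FH or TP_FK; nothing here proves or refutes FK continuity.  "Refuted" applies to the WIRED twins of
crux C3 / of the `UFSC0` criterion ONLY — the kernel form of "the continuation principle is boundary-condition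
sensitive", i.e. of why C3a / FH are, and must be, FREE-side statements.  In detail: (i) C2 forbids a sound
robustly-lawful FK history scheme AT `p = p_c(q)` (`not_fkRobustLawful_rcCriticalProb`, the C1-level form of "no
finite-size criterion at criticality"; the `UFSC0`-level form `noUFSC0AtCritical` is row FT-07's leaf
`Transplant/KNFreeTheorem6Consequences.lean`, C2 ∧ C3b, imported here by name); (ii) the crux family is PLACED against
the barrier by kernel theorems rather than prose:

* the WIRED twin of crux C3 ("wired percolation at `p` yields a sound robustly-lawful scheme at `p`") is FALSE for
  every `d ≥ 2` and all `q > Q(d)` (`not_wiredSchemeCriterion_of_large_q`): at `p = p_c(q) ∈ (0,1)` the wired phase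
  percolates, yet by (i) no such scheme exists — the kernel form of "the continuation principle is boundary-condition
  SENSITIVE", i.e. of why the open input FH / C3a of the cell is, and must be, a FREE-side statement
  (barrier note `Literature.Barriers.CriticalPhenomena.SamePFreeBoundaryCriteria`);
* the FREE crux C3a (`FKCriterionOfThetaFree`) is NOT touched by the barrier at `p_c(q)`: for `q > Q(d)` its
  hypothesis `0 < θ⁰(p_c(q), q)` is void (`fkContinuityFree_of_large_q`, `criterionOfThetaFree_at_critical_of_large_q`)
  — the formal content of the remark "(there it is vacuous for `q > Q(d)`)" in row FO-05's `ContinuityCruxDefs`;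
* (`UFSC0` level, through FT-07's `noUFSC0AtCritical`) the WIRED twin of C3a — "`θ¹(p, q) > 0` ⇒ `UFSC0` at `p` at
  some scale" — is FALSE for `q > Q(d)` (`not_wiredUFSC0Criterion_of_large_q`), while the FREE criterion's instance at
  `p_c(q)` holds vacuously (`free_vs_wired_criterion_at_critical_of_large_q`);
* `q`-SENSITIVITY CERTIFICATE (`d ≥ 3`): the wired criteria HOLD at `q = 1` — `θ¹(p,1) = θ(p)` (row FO-02) and the
  `q = 1` regression `ufsc0_one_of_theta_pos` (row FT-09), by name — and FAIL for every `q > Q(d)`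
  (`wiredUFSC0Criterion_q_sensitive`, `wiredSchemeCriterion_q_sensitive`): no argument uniform in `q ≥ 1` can prove
  them — the D-0021 block of `RandomClusterFirstOrderNarrow` instantiated on the cell's crux, as kernel theorems;
* for EVERY `q ≥ 1` (no barrier needed): at `p = p_c(q)` the free crux IS the target — the `p_c(q)`-instance of
  C3a is EQUIVALENT to `FKContinuityFree d q` (`criterionOfThetaFree_at_critical_iff_fkContinuityFree`; → via
  `noUFSC0AtCritical`, ← vacuous), and C3a is the ONE remaining binder of row FO-05's composition
  (`fkContinuityFree_of_criterionOfThetaFree`, `fkFreeCriticalZ3_of_criterionOfThetaFreeZ3`) — the kernel form of the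
  FO-18 memo's "input ≡ target at `p_c`" (theorems offered by fkp-18a g25; its `q = 1` instance is FT-09's
  `fkCriterionOfThetaFree_one`, for `q > 1` it is OPEN and nothing is claimed);
* for the record, row FO-01's target-level placements (`ContinuityTargets` §4, stated on `ℤ³` under the hypothesis
  `(hB : RandomClusterFirstOrderNarrow)`) are discharged and extended to every `d ≥ 2`
  (`not_fkContinuityWired_of_large_q`, `not_fkTransferAtCritical_of_large_q`, `not_wiredAllQ_of_two_le`), and the
  "agreement" sentence of row FO-12 is one theorem (`firstOrder_coexistence_at_critical`): at `p_c(q)`, `q > Q(d)`,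
  wired percolation, free non-percolation and the absence of every sound robustly-lawful scheme hold TOGETHER.

Neighbours cited or used BY NAME, not restated: `ufsc0_one_of_theta_pos` (FT-09), `thetaWired_one_right_eq_theta` (FO-02), `noUFSC0AtCritical_of` (FO-05 seam, `ContinuityCruxDefs`), `noUFSC0AtCritical_one`
(FT-09, `q = 1`), `noUFSC0AtCritical` (FT-07g, general `q`), the SameP-vocabulary forms
`SameP.not_regionLawful_rcCriticalProb` / `not_lawLawful_rcCriticalProb` / `not_pinnedLawful_rcCriticalProb` (FO-11),
and FO-01's `wired_fails_for_large_q` / `free_holds_for_large_q` / `not_wiredAllQ` (recovered here BY NAME).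

## References

* G. Grimmett, *The Random-Cluster Model*, Springer 2006: Thm. (5.5) (5.9); §5.1 (5.1)–(5.2); Conj. (5.103);
  Conj. (6.32)(a); Thm. (7.33)(b) and its proof, eqs. (7.78)–(7.83). [Grimmett2006]
* G. Kozma, S. Nitzan, arXiv:2401.12397 (2024), §1 p. 2 (approach 1), §4 p. 25. [KozmaNitzan2024]
* L. Laanait, A. Messager, S. Miracle-Solé, J. Ruiz, S. Shlosman, Comm. Math. Phys. 140 (1991) 81–91.
  [LaanaitMessagerMiracleSoleRuizShlosman1991]
-/

noncomputable section

namespace Summit.CriticalPhenomena.PercolationContinuityZ3.Theorems.FK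

open Literature.Probability.Percolation Literature.Probability.LatticeModels Literature.Barriers.CriticalPhenomena

variable {d : ℕ} {q : ℝ}

/-! ### 1. No criterion at criticality (C1 level), from C2 alone -/

/-- **No sound FK history scheme is robustly lawful at `p = p_c(q)`** (`d ≥ 2`, `q ≥ 1`, `ε < 2⁻³²`): the C1-level
form of "no finite-size criterion at criticality" — the continuation principle C2 (`fkContinuationPrinciple`) at
`p = p_c(q) ∈ (0,1)` (Grimmett Thm. (5.5)) would give `p_c(q) < p_c(q)`.
[cite: KozmaNitzan2024, §1 p. 2 (approach 1)] [cite: Grimmett2006, Thm. (5.5) (5.9)] -/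
theorem not_fkRobustLawful_rcCriticalProb (hd : 2 ≤ d) (hq : 1 ≤ q) {ε : ℝ} (hε : ε < (1 / 2 : ℝ) ^ 32)
    {N : ℕ} {E : FKScheme d} (hS : E.Sound) :
    ¬FKRobustLawful d q ⟨rcCriticalProb d q, rcCriticalProb_mem_Icc d q⟩ ε N E := fun hL =>
  lt_irrefl _
    (fkContinuationPrinciple hq ⟨rcCriticalProb d q, rcCriticalProb_mem_Icc d q⟩ ε N E hL hε
      (rcCriticalProb_mem_Ioo hd hq).1 (rcCriticalProb_mem_Ioo hd hq).2 hS)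

/-- Equivalent reading: a sound scheme robustly lawful at `(p, ε)` with `ε < 2⁻³²`, `0 < p < 1`, lives STRICTLY
above criticality — `p ≠ p_c(q)` (indeed `p_c(q) < p`, which is C2 itself). [cite: KozmaNitzan2024, §1 p. 2 (approach 1)] -/
theorem ne_rcCriticalProb_of_fkRobustLawful (hq : 1 ≤ q) {p : unitInterval} {ε : ℝ} (hε : ε < (1 / 2 : ℝ) ^ 32)
    (hp0 : 0 < (p : ℝ)) (hp1 : (p : ℝ) < 1) {N : ℕ} {E : FKScheme d} (hL : FKRobustLawful d q p ε N E)
    (hS : E.Sound) : (p : ℝ) ≠ rcCriticalProb d q :=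
  (fkContinuationPrinciple hq p ε N E hL hε hp0 hp1 hS).ne'

/-! ### 2. The wired twin of crux C3 is refuted for large `q` (barrier placement of the crux family) -/

/-- **The WIRED scheme criterion fails for `q > Q(d)`** (`d ≥ 2`): it is NOT the case that at every `p ∈ (0,1)`
with `θ¹(p, q) > 0` some sound FK history scheme is robustly lawful with `ε < 2⁻³²`.  Witness `p = p_c(q)`: the wired
phase percolates there (Grimmett Thm. (7.33)(b), tree theorem `RandomClusterFirstOrderNarrow_holds`) while
`not_fkRobustLawful_rcCriticalProb` forbids the scheme.  Hence no `q`-uniform argument can manufacture the cell's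
criterion from WIRED percolation: the continuation principle is boundary-condition sensitive, and the cell's open
input (FH / C3a) is necessarily a FREE-side statement.
[cite: Grimmett2006, Thm. (7.33)(b) and proof, eqs. (7.78)–(7.83)] [cite: KozmaNitzan2024, §1 p. 2 (approach 1)] -/
theorem not_wiredSchemeCriterion_of_large_q (hd : 2 ≤ d) :
    ∃ Q : ℝ, ∀ q : ℝ, Q < q → 1 ≤ q →
      ¬ (∀ p : unitInterval, 0 < (p : ℝ) → (p : ℝ) < 1 → 0 < thetaWired d p q →
          ∃ (ε : ℝ) (N : ℕ) (E : FKScheme d), ε < (1 / 2 : ℝ) ^ 32 ∧ FKRobustLawful d q p ε N E ∧ E.Sound) := by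
  obtain ⟨Q, hQ⟩ := RandomClusterFirstOrderNarrow_holds d hd
  refine ⟨Q, fun q hQq hq hcrit => ?_⟩
  obtain ⟨ε, N, E, hε, hL, hS⟩ := hcrit ⟨rcCriticalProb d q, rcCriticalProb_mem_Icc d q⟩
    (rcCriticalProb_mem_Ioo hd hq).1 (rcCriticalProb_mem_Ioo hd hq).2 (hQ q hQq hq).2
  exact not_fkRobustLawful_rcCriticalProb hd hq hε hS hL

/-- The same with ONE precision `ε < 2⁻³²` fixed in advance (the shape in which C3a ∧ C3b deliver the free-side
criterion, `ε = 4ε₀`): also refuted for `q > Q(d)`. [cite: Grimmett2006, Thm. (7.33)(b)] -/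
theorem not_wiredSchemeCriterion_of_large_q' (hd : 2 ≤ d) {ε : ℝ} (hε : ε < (1 / 2 : ℝ) ^ 32) :
    ∃ Q : ℝ, ∀ q : ℝ, Q < q → 1 ≤ q →
      ¬ (∀ p : unitInterval, 0 < (p : ℝ) → (p : ℝ) < 1 → 0 < thetaWired d p q →
          ∃ (N : ℕ) (E : FKScheme d), FKRobustLawful d q p ε N E ∧ E.Sound) := by
  obtain ⟨Q, hQ⟩ := not_wiredSchemeCriterion_of_large_q hd
  refine ⟨Q, fun q hQq hq hcrit => hQ q hQq hq fun p hp0 hp1 hθ => ?_⟩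
  obtain ⟨N, E, hL, hS⟩ := hcrit p hp0 hp1 hθ
  exact ⟨ε, N, E, hε, hL, hS⟩

/-! ### 3. The free crux is not touched at `p_c(q)`: `θ⁰(p_c(q), q) = 0` for large `q`, every `d ≥ 2` -/

/-- **`θ⁰(p_c(q), q) = 0` for all `q > Q(d)`, every `d ≥ 2` — unconditional** (the free half of Grimmett Thm.
(7.33)(b), tree theorem `RandomClusterFirstOrderNarrow_holds`, read through `thetaFree_eq_zero_iff_mem_freeDecaySet`).
Row FO-01's `free_holds_for_large_q` is the case `d = 3` under the hypothesis `RandomClusterFirstOrderNarrow`.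
[cite: Grimmett2006, Thm. (7.33)(b) and proof, eqs. (7.81)–(7.83), with §5.1 (5.1)] -/
theorem fkContinuityFree_of_large_q (hd : 2 ≤ d) :
    ∃ Q : ℝ, ∀ q : ℝ, Q < q → 1 ≤ q → FKContinuityFree d q := by
  obtain ⟨Q, hQ⟩ := RandomClusterFirstOrderNarrow_holds d hd
  exact ⟨Q, fun q hQq hq =>
    (thetaFree_eq_zero_iff_mem_freeDecaySet (rcCriticalProb_mem_Icc d q) (by linarith)).2 (hQ q hQq hq).1⟩

/-- **C3a at `p = p_c(q)` is vacuous for `q > Q(d)`**: the `p = p_c(q)` instance of `FKCriterionOfThetaFree d q ε₀`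
holds for EVERY `ε₀`, because its hypothesis `0 < θ⁰(p_c(q), q)` is void — the barrier cannot refute the free crux at
criticality (contrast `not_wiredSchemeCriterion_of_large_q`).  This is the formal content of "(there it is vacuous
for `q > Q(d)`)" in the docstring of `FKCriterionOfThetaFree`. [cite: Grimmett2006, Thm. (7.33)(b), Conj. (5.103)] -/
theorem criterionOfThetaFree_at_critical_of_large_q (hd : 2 ≤ d) :
    ∃ Q : ℝ, ∀ q : ℝ, Q < q → 1 ≤ q → ∀ ε₀ : ℝ,
      0 < thetaFree d (rcCriticalProb d q) q →
        ∃ r : ℕ, UFSC0 d q ⟨rcCriticalProb d q, rcCriticalProb_mem_Icc d q⟩ r ε₀ := by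
  obtain ⟨Q, hQ⟩ := fkContinuityFree_of_large_q hd
  exact ⟨Q, fun q hQq hq ε₀ hpos => absurd (hQ q hQq hq) hpos.ne'⟩

/-! ### 4. Row FO-01's target-level placements, hypothesis discharged and every `d ≥ 2` -/

/-- **T_W fails for `q > Q(d)`**, every `d ≥ 2`, unconditional: `θ¹(p_c(q), q) > 0`.
(FO-01 `wired_fails_for_large_q`: `d = 3` under `RandomClusterFirstOrderNarrow`.) [cite: Grimmett2006, Thm. (7.33)(b)] -/
theorem not_fkContinuityWired_of_large_q (hd : 2 ≤ d) :
    ∃ Q : ℝ, ∀ q : ℝ, Q < q → 1 ≤ q → ¬FKContinuityWired d q := by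
  obtain ⟨Q, hQ⟩ := RandomClusterFirstOrderNarrow_holds d hd
  exact ⟨Q, fun q hQq hq hW => (hQ q hQq hq).2.ne' hW⟩

/-- **The transfer T_U fails for `q > Q(d)`**, every `d ≥ 2`, unconditional: at `p_c(q)` the free phase does not
percolate but the wired phase does, so `FKTransferAtCritical d q` (T_F → T_W, the uniqueness seam at `p_c(q)`) is
false — the residual of the cell's `q ∈ (1,2)` filing (Raoufi 2020 Question 4) is `q`-sensitive.
[cite: Grimmett2006, Thm. (7.33)(b)] [cite: Raoufi2020, Question 4] -/
theorem not_fkTransferAtCritical_of_large_q (hd : 2 ≤ d) :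
    ∃ Q : ℝ, ∀ q : ℝ, Q < q → 1 ≤ q → ¬FKTransferAtCritical d q := by
  obtain ⟨Q₁, h₁⟩ := fkContinuityFree_of_large_q hd
  obtain ⟨Q₂, h₂⟩ := not_fkContinuityWired_of_large_q hd
  refine ⟨max Q₁ Q₂, fun q hQq hq hT => ?_⟩
  obtain ⟨hq₁, hq₂⟩ := max_lt_iff.1 hQq
  exact h₂ q hq₂ hq (hT (h₁ q hq₁ hq))

/-- **Negative control, every `d ≥ 2`, unconditional**: the `q`-uniform WIRED target "T_W(d,q) for every `q ≥ 1`"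
is false (FO-01 `not_wiredAllQ`: `d = 3` under `RandomClusterFirstOrderNarrow`). [cite: Grimmett2006, Thm. (7.33)(b)] -/
theorem not_wiredAllQ_of_two_le (hd : 2 ≤ d) : ¬ ∀ q : ℝ, 1 ≤ q → FKContinuityWired d q := by
  obtain ⟨Q, hQ⟩ := not_fkContinuityWired_of_large_q hd
  intro h
  have hq : 1 ≤ max Q 1 + 1 := by linarith [le_max_right Q 1]
  exact hQ (max Q 1 + 1) (by linarith [le_max_left Q 1]) hq (h _ hq)

/-- FO-01's three `ℤ³` placements with the barrier hypothesis DISCHARGED by the tree theorem.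
[cite: Grimmett2006, Thm. (7.33)(b)] -/
theorem wired_fails_free_holds_z3 :
    (∃ Q : ℝ, ∀ q : ℝ, Q < q → 1 ≤ q → ¬FKContinuityWired 3 q) ∧
      (∃ Q : ℝ, ∀ q : ℝ, Q < q → 1 ≤ q → FKContinuityFree 3 q) ∧ ¬ ∀ q : ℝ, 1 ≤ q → FKContinuityWired 3 q :=
  ⟨wired_fails_for_large_q RandomClusterFirstOrderNarrow_holds,
    free_holds_for_large_q RandomClusterFirstOrderNarrow_holds, not_wiredAllQ RandomClusterFirstOrderNarrow_holds⟩

/-! ### 5. The agreement sentence of row FO-12, as one theorem -/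

/-- **Coexistence at criticality for `q > Q(d)`** (`d ≥ 2`, unconditional): at `p = p_c(q)` the WIRED phase
percolates, the FREE phase does not, and NO sound FK history scheme is robustly lawful at any precision `ε < 2⁻³²`
— the first-order transition (Grimmett Thm. (7.33)(b)) and the continuation principle C2 hold together; the barrier
bites on the wired side only. [cite: Grimmett2006, Thm. (7.33)(b) and proof, eqs. (7.78)–(7.83)] [cite: KozmaNitzan2024, §1 p. 2 (approach 1)] -/
theorem firstOrder_coexistence_at_critical (hd : 2 ≤ d) :
    ∃ Q : ℝ, ∀ q : ℝ, Q < q → 1 ≤ q →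
      0 < thetaWired d (rcCriticalProb d q) q ∧ thetaFree d (rcCriticalProb d q) q = 0 ∧
        ∀ (ε : ℝ) (N : ℕ) (E : FKScheme d), ε < (1 / 2 : ℝ) ^ 32 → E.Sound →
          ¬FKRobustLawful d q ⟨rcCriticalProb d q, rcCriticalProb_mem_Icc d q⟩ ε N E := by
  obtain ⟨Q, hQ⟩ := RandomClusterFirstOrderNarrow_holds d hd
  refine ⟨Q, fun q hQq hq => ⟨(hQ q hQq hq).2, ?_, fun ε N E hε hS => not_fkRobustLawful_rcCriticalProb hd hq hε hS⟩⟩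
  exact (thetaFree_eq_zero_iff_mem_freeDecaySet (rcCriticalProb_mem_Icc d q) (by linarith)).2 (hQ q hQq hq).1

/-! ### 6. The `UFSC0`-level wired twin of C3a, refuted for large `q` (through FT-07's `noUFSC0AtCritical`) -/

/-- **The WIRED twin of crux C3a fails for `q > Q(d)`** (`d ≥ 2`, `4ε₀ < 2⁻³²`): it is NOT the case that at every
`p ∈ (0,1)` with `θ¹(p, q) > 0` the uniform finite-size criterion `UFSC0 d q p r ε₀` holds at some scale `r`.
Witness `p = p_c(q)`: wired percolation (Grimmett Thm. (7.33)(b), tree theorem) against `noUFSC0AtCritical`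
(C2 ∧ C3b, row FT-07's leaf).  So C3a (`FKCriterionOfThetaFree`, hypothesis `θ⁰(p, q) > 0`) is stated on the only
side of the boundary-condition seam NOT refuted by the barrier uniformly in `q ≥ 1` (whether C3a itself holds for
`q > 1` is OPEN — it is the cell's input FH ∧ TP_FK; nothing here bears on it).
[cite: Grimmett2006, Thm. (7.33)(b), Conj. (5.103)] [cite: KozmaNitzan2024, §4 Theorem 6] -/
theorem not_wiredUFSC0Criterion_of_large_q (hd : 2 ≤ d) {ε₀ : ℝ} (hε₀ : 4 * ε₀ < (1 / 2 : ℝ) ^ 32) :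
    ∃ Q : ℝ, ∀ q : ℝ, Q < q → 1 ≤ q →
      ¬ (∀ p : unitInterval, 0 < (p : ℝ) → (p : ℝ) < 1 → 0 < thetaWired d p q → ∃ r : ℕ, UFSC0 d q p r ε₀) := by
  obtain ⟨Q, hQ⟩ := RandomClusterFirstOrderNarrow_holds d hd
  refine ⟨Q, fun q hQq hq hcrit => ?_⟩
  obtain ⟨r, hU⟩ := hcrit ⟨rcCriticalProb d q, rcCriticalProb_mem_Icc d q⟩
    (rcCriticalProb_mem_Ioo hd hq).1 (rcCriticalProb_mem_Ioo hd hq).2 (hQ q hQq hq).2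
  exact noUFSC0AtCritical hd hq hε₀ r hU

/-- **At `p_c(q)`, `q > Q(d)`: the free criterion's instance holds, the wired twin's instance fails** (`d ≥ 2`,
`4ε₀ < 2⁻³²`) — the two sides of Grimmett's Thm. (7.33)(b) read through `UFSC0`: `θ⁰(p_c(q), q) = 0` voids the
hypothesis of C3a, `θ¹(p_c(q), q) > 0` and `noUFSC0AtCritical` refute its wired twin.
[cite: Grimmett2006, Thm. (7.33)(b), Conj. (5.103)] -/
theorem free_vs_wired_criterion_at_critical_of_large_q (hd : 2 ≤ d) {ε₀ : ℝ} (hε₀ : 4 * ε₀ < (1 / 2 : ℝ) ^ 32) :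
    ∃ Q : ℝ, ∀ q : ℝ, Q < q → 1 ≤ q →
      (0 < thetaFree d (rcCriticalProb d q) q →
          ∃ r : ℕ, UFSC0 d q ⟨rcCriticalProb d q, rcCriticalProb_mem_Icc d q⟩ r ε₀) ∧
        ¬ (0 < thetaWired d (rcCriticalProb d q) q →
          ∃ r : ℕ, UFSC0 d q ⟨rcCriticalProb d q, rcCriticalProb_mem_Icc d q⟩ r ε₀) := by
  obtain ⟨Q, hQ⟩ := RandomClusterFirstOrderNarrow_holds d hd
  refine ⟨Q, fun q hQq hq => ⟨fun hpos => ?_, fun hwired => ?_⟩⟩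
  · exact absurd ((thetaFree_eq_zero_iff_mem_freeDecaySet (rcCriticalProb_mem_Icc d q) (by linarith)).2
      (hQ q hQq hq).1) hpos.ne'
  · obtain ⟨r, hU⟩ := hwired (hQ q hQq hq).2
    exact noUFSC0AtCritical hd hq hε₀ r hU

/-! ### 7. `q`-sensitivity certificate: the wired criteria HOLD at `q = 1` (d ≥ 3) and FAIL for `q > Q(d)` -/

/-- **At `q = 1` the wired `UFSC0` criterion holds** (`d ≥ 3`, `ε₀ > 0`): `θ¹(p, 1) = θ(p)` (FO-02) and the `q = 1`
regression of the transplant record (`ufsc0_one_of_theta_pos`, FT-09; cone via p205010's additive gluing).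
[cite: KozmaNitzan2024, §4 Theorem 6 (pp. 25–31) with Lemmas 9–12] [cite: Grimmett2006, §5.1 (5.1)] -/
theorem wiredUFSC0Criterion_one (hd : 3 ≤ d) {ε₀ : ℝ} (hε₀ : 0 < ε₀) :
    ∀ p : unitInterval, 0 < (p : ℝ) → (p : ℝ) < 1 → 0 < thetaWired d p 1 → ∃ r : ℕ, UFSC0 d 1 p r ε₀ := by
  intro p hp0 hp1 hθ
  rw [thetaWired_one_right_eq_theta] at hθ
  exact ufsc0_one_of_theta_pos hd p hp0 hp1 hθ hε₀

/-- **At `q = 1` the wired SCHEME criterion holds** (`d ≥ 3`, `0 < ε₀`, precision `4ε₀`): wired percolation at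
`p ∈ (0,1)` yields a sound FK history scheme robustly lawful at `(p, 4ε₀)` — `wiredUFSC0Criterion_one` and C3b
(`fkLawfulOfCriterion`, FT-07). [cite: KozmaNitzan2024, §4 Theorem 6 (pp. 25–31)] -/
theorem wiredSchemeCriterion_one (hd : 3 ≤ d) {ε₀ : ℝ} (hε₀ : 0 < ε₀) :
    ∀ p : unitInterval, 0 < (p : ℝ) → (p : ℝ) < 1 → 0 < thetaWired d p 1 →
      ∃ (N : ℕ) (E : FKScheme d), FKRobustLawful d 1 p (4 * ε₀) N E ∧ E.Sound := by
  intro p hp0 hp1 hθ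
  obtain ⟨r, hU⟩ := wiredUFSC0Criterion_one hd hε₀ p hp0 hp1 hθ
  exact fkLawfulOfCriterion le_rfl p r ε₀ hU

/-- **`q`-SENSITIVITY of the wired `UFSC0` criterion** (`d ≥ 3`, `0 < ε₀`, `4ε₀ < 2⁻³²`): TRUE at `q = 1`, FALSE for
every `q > Q(d)`.  Hence no argument uniform in `q ≥ 1` proves it, and the free-side statement C3a is the only
`q`-uniform candidate — the D-0021 barrier of `Literature.Barriers.CriticalPhenomena.RandomClusterFirstOrderNarrow`
instantiated on the cell's crux, as a kernel theorem. [cite: Grimmett2006, Thm. (7.33)(b), Conj. (5.103), Conj. (6.32)(a)]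
[cite: KozmaNitzan2024, §4 Theorem 6] -/
theorem wiredUFSC0Criterion_q_sensitive (hd : 3 ≤ d) {ε₀ : ℝ} (hε₀ : 0 < ε₀) (hε₀' : 4 * ε₀ < (1 / 2 : ℝ) ^ 32) :
    (∀ p : unitInterval, 0 < (p : ℝ) → (p : ℝ) < 1 → 0 < thetaWired d p 1 → ∃ r : ℕ, UFSC0 d 1 p r ε₀) ∧
      ∃ Q : ℝ, ∀ q : ℝ, Q < q → 1 ≤ q →
        ¬ (∀ p : unitInterval, 0 < (p : ℝ) → (p : ℝ) < 1 → 0 < thetaWired d p q → ∃ r : ℕ, UFSC0 d q p r ε₀) :=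
  ⟨wiredUFSC0Criterion_one hd hε₀, not_wiredUFSC0Criterion_of_large_q (by omega) hε₀'⟩

/-- **`q`-SENSITIVITY of the wired SCHEME criterion** (`d ≥ 3`, `0 < ε`, `ε < 2⁻³²`): at `q = 1` wired percolation
yields a sound scheme robustly lawful at precision `ε`; for `q > Q(d)` it does not (witness `p_c(q)`).
[cite: Grimmett2006, Thm. (7.33)(b)] [cite: KozmaNitzan2024, §1 p. 2 (approach 1), §4 Theorem 6] -/
theorem wiredSchemeCriterion_q_sensitive (hd : 3 ≤ d) {ε : ℝ} (hε : 0 < ε) (hε' : ε < (1 / 2 : ℝ) ^ 32) :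
    (∀ p : unitInterval, 0 < (p : ℝ) → (p : ℝ) < 1 → 0 < thetaWired d p 1 →
        ∃ (N : ℕ) (E : FKScheme d), FKRobustLawful d 1 p ε N E ∧ E.Sound) ∧
      ∃ Q : ℝ, ∀ q : ℝ, Q < q → 1 ≤ q →
        ¬ (∀ p : unitInterval, 0 < (p : ℝ) → (p : ℝ) < 1 → 0 < thetaWired d p q →
          ∃ (N : ℕ) (E : FKScheme d), FKRobustLawful d q p ε N E ∧ E.Sound) := by
  refine ⟨fun p hp0 hp1 hθ => ?_, not_wiredSchemeCriterion_of_large_q' (by omega) hε'⟩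
  have h4 : 0 < ε / 4 := by positivity
  obtain ⟨N, E, hL, hS⟩ := wiredSchemeCriterion_one hd h4 p hp0 hp1 hθ
  exact ⟨N, E, by simpa only [mul_div_cancel₀ ε (four_ne_zero)] using hL, hS⟩


/-! ### 8. At criticality the free crux IS the target (every `q ≥ 1`; offered by fkp-18a g25, scratch `c3a_at_pc_iff.lean`) -/

/-- **C3a alone now gives the free target** (`d ≥ 2`, `q ≥ 1`, `4ε₀ < 2⁻³²`): in row FO-05's composition
`fkContinuityFree_of_cruxes` the binders C2 and C3b are discharged by name (`fkContinuationPrinciple`,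
`fkLawfulOfCriterion`) and `p_c(q) < 1` by `rcCriticalProb_lt_one`, so `FKCriterionOfThetaFree d q ε₀` is the ONE
remaining hypothesis.  (Its `q = 1` instance is the tree theorem `fkCriterionOfThetaFree_one`; for `q > 1` it is the
cell's OPEN input — nothing is claimed.) [cite: KozmaNitzan2024, §1 p. 2 (approach 1), §4 Theorem 6] [cite: Grimmett2006, Conj. (6.32)(a), Conj. (5.103)] -/
theorem fkContinuityFree_of_criterionOfThetaFree (hd : 2 ≤ d) (hq : 1 ≤ q) {ε₀ : ℝ}
    (hε₀ : 4 * ε₀ < (1 / 2 : ℝ) ^ 32) (h3a : FKCriterionOfThetaFree d q ε₀) : FKContinuityFree d q :=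
  fkContinuityFree_of_cruxes hq (rcCriticalProb_mem_Ioo hd hq).2 hε₀ (fkContinuationPrinciple hq) h3a
    (fkLawfulOfCriterion hq)

/-- **On `ℤ³`: C3a for every `q ≥ 1` alone gives Grimmett's Conj. (6.32)(a) on `ℤ³`** (`FKFreeCriticalZ3`), at any
precision with `4ε₀ < 2⁻³²` — row FO-05's `fkFreeCriticalZ3_of_cruxes` with C2-Z3, C3b-Z3 and `p_c(q) < 1` discharged by
name.  (OPEN hypothesis for `q > 1`; nothing is claimed.) [cite: Grimmett2006, Conj. (6.32)(a)] [cite: KozmaNitzan2024, §1 p. 2 (approach 1)] -/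
theorem fkFreeCriticalZ3_of_criterionOfThetaFreeZ3 {ε₀ : ℝ} (hε₀ : 4 * ε₀ < (1 / 2 : ℝ) ^ 32)
    (h3a : FKCriterionOfThetaFreeZ3 ε₀) : FKFreeCriticalZ3 :=
  fkFreeCriticalZ3_of_cruxes (fun _ hq => rcCriticalProb_lt_one (by norm_num) hq) hε₀ fkContinuationZ3 h3a
    fkLawfulOfCriterionZ3

/-- **The target gives C3a's `p_c(q)`-instance, vacuously** (every `d`, `q`, `ε₀`): if `θ⁰(p_c(q), q) = 0` then the
hypothesis `0 < θ⁰(p_c(q), q)` is void. [cite: Grimmett2006, Conj. (6.32)(a), Conj. (5.103)] -/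
theorem criterionOfThetaFree_at_critical_of_fkContinuityFree {ε₀ : ℝ} (h0 : FKContinuityFree d q) :
    0 < thetaFree d (rcCriticalProb d q) q →
      ∃ r : ℕ, UFSC0 d q ⟨rcCriticalProb d q, rcCriticalProb_mem_Icc d q⟩ r ε₀ :=
  fun hpos => absurd ((fkContinuityFree_iff d q).1 h0) hpos.ne'

/-- **At `p = p_c(q)` the free crux IS the target** (`d ≥ 2`, `q ≥ 1`, `4ε₀ < 2⁻³²`, unconditional): the
`p_c(q)`-instance of C3a `FKCriterionOfThetaFree d q ε₀` is EQUIVALENT to `FKContinuityFree d q` (→ through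
`noUFSC0AtCritical`, C2 ∧ C3b; ← vacuous).  So the one instance of C3a that row FO-05's composition consumes is
logically the target itself (FO-18 memo: "input ≡ target at `p_c`"); the `p > p_c(q)` instances (Conj. (5.103)-type
content, FH ∧ TP_FK via `_r3`) are not consumed.  Complements the large-`q` vacuity witness
`criterionOfThetaFree_at_critical_of_large_q` with the all-`q` two-way form.
[cite: Grimmett2006, Conj. (6.32)(a), Conj. (5.103)] [cite: KozmaNitzan2024, §4 Theorem 6] -/
theorem criterionOfThetaFree_at_critical_iff_fkContinuityFree (hd : 2 ≤ d) (hq : 1 ≤ q) {ε₀ : ℝ}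
    (hε₀ : 4 * ε₀ < (1 / 2 : ℝ) ^ 32) :
    (0 < thetaFree d (rcCriticalProb d q) q →
        ∃ r : ℕ, UFSC0 d q ⟨rcCriticalProb d q, rcCriticalProb_mem_Icc d q⟩ r ε₀) ↔
      FKContinuityFree d q := by
  refine ⟨fun h => ?_, criterionOfThetaFree_at_critical_of_fkContinuityFree⟩
  by_contra hne
  obtain ⟨r, hU⟩ := h (lt_of_le_of_ne (thetaFree_nonneg _ _) (Ne.symm hne))
  exact noUFSC0AtCritical hd hq hε₀ r hU

end Summit.CriticalPhenomena.PercolationContinuityZ3.Theorems.FK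

end
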